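import Literature.AlgebraicGeometry.Resolution.PCyclicBoundaryType
import Mathlib.RingTheory.Localization.LocalizationLocalization
import Mathlib.RingTheory.Localization.AtPrime.Basic
import Mathlib.RingTheory.Ideal.GoingUp
import Mathlib.RingTheory.Polynomial.Basic
import HarnessLib

/-!
# Local rings of an integral extension over a unibranch point, and transport along a
# localization tower

Topic: `Literature/AlgebraicGeometry/Resolution`. Bookkeeping on localizations used to pass
from the sections `A = Γ(W, U) → B = Γ(Y^ν, V)` of the normalised `p`-cyclic cover of the
endgame of the crux `PicoverLocalModel` to its local rings:

* `IsLocalization.atPrime_of_isLocalRing` — for an integral extension `A → B`, a prime `𝔓`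
  of `B` over `𝔮`, and the localization `M = B ⊗_A A_𝔮` of `B` at the image of `A ∖ 𝔮`: if
  `M` is local ("`B` is unibranch over `𝔮`"), then `M` is the localization of `B` at `𝔓`
  (incomparability: the contraction of `𝔪_M` is `𝔓`), so `M ≅ B_𝔓` is the local ring of
  the cover at the point `𝔓`;
* `exists_mul_eq_aeval_of_isLocalization` — birationality `d · z ∈ A[t]` (`d ∈ A ∖ 0`) of
  `B` over `A[t]` passes to `M` over `A_𝔮[t]`;
* `isWoundTypeAt_iff_of_ringEquiv`, `isLocalization_atPrime_span_of_tower`,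
  `isWoundTypeAt_of_atPrime_tower` — the wound type of the radicand along a boundary
  component `𝔭 = (x) ⊆ A`, read in the discrete valuation ring `(A_{𝔮₀})_{(x)} = A_𝔭` at one
  point `𝔮₀ ⊇ 𝔭`, is the same at every other point `𝔮 ⊇ 𝔭` (both are `A_𝔭`).

Sources: [Kato1994] K. Kato, *Toric singularities*, Amer. J. Math. 116 (1994) (context only;
all statements folklore). [Giraud1983] J. Giraud, Bull. SMF 111 (1983), Prop. 1.5 (types).
-/

namespace Literature.AlgebraicGeometry.Resolution

open IsLocalRing Polynomial

/-! ## The local ring over a unibranch point -/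

/-- **Over a unibranch point the base-changed localization is the local ring.** Let `A → B`
be integral, `𝔓 ⊂ B` a prime over `𝔮 = 𝔓 ∩ A`, and `M` the localization of `B` at the image
of `A ∖ 𝔮`. If `M` is a local ring then `M` is the localization of `B` at `𝔓`: every element
of `B ∖ 𝔓` is a unit of `M`, because the contraction `𝔓₀` of `𝔪_M` contains `𝔓`, lies over
`𝔮`, hence equals `𝔓` by incomparability in the integral extension `A ⊆ B`. [folklore] -/
theorem IsLocalization.atPrime_of_isLocalRing {A B : Type*} [CommRing A] [CommRing B]
    [Algebra A B] [Algebra.IsIntegral A B] (𝔓 : Ideal B) [𝔓.IsPrime] (M : Type*) [CommRing M]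
    [Algebra B M]
    [IsLocalization (Algebra.algebraMapSubmonoid B (𝔓.comap (algebraMap A B)).primeCompl) M]
    [IsLocalRing M] : IsLocalization.AtPrime M 𝔓 := by
  set 𝔮 := 𝔓.comap (algebraMap A B) with h𝔮
  set S := Algebra.algebraMapSubmonoid B 𝔮.primeCompl with hS
  have hS𝔓 : S ≤ 𝔓.primeCompl := by
    intro b hb
    obtain ⟨a, ha, rfl⟩ := Submonoid.mem_map.mp hb
    exact ha
  have hdisj : Disjoint (S : Set B) 𝔓 := by
    rw [Set.disjoint_left]
    intro b hb hb𝔓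
    exact hS𝔓 hb hb𝔓
  -- the contraction of the maximal ideal of `M`
  set 𝔓₀ : Ideal B := (maximalIdeal M).comap (algebraMap B M) with h𝔓₀
  have h1 : 𝔓 ≤ 𝔓₀ := by
    have hprime : (𝔓.map (algebraMap B M)).IsPrime :=
      IsLocalization.isPrime_of_isPrime_disjoint S M 𝔓 ‹_› hdisj
    rw [h𝔓₀, ← Ideal.map_le_iff_le_comap]
    exact IsLocalRing.le_maximalIdeal hprime.ne_top
  have h2 : 𝔓₀.comap (algebraMap A B) ≤ 𝔮 := by
    intro a ha
    by_contra ha'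
    have hunit : IsUnit (algebraMap B M (algebraMap A B a)) :=
      IsLocalization.map_units M (⟨algebraMap A B a,
        Submonoid.mem_map.mpr ⟨a, Ideal.mem_primeCompl_iff.mpr ha', rfl⟩⟩ : S)
    rw [Ideal.mem_comap, h𝔓₀, Ideal.mem_comap] at ha
    exact (IsLocalRing.mem_maximalIdeal _).mp ha hunit
  have heq : 𝔓 = 𝔓₀ := by
    by_contra hne
    have hlt : 𝔓 < 𝔓₀ := lt_of_le_of_ne h1 hne
    have := Ideal.IsIntegral.comap_lt_comap (R := A) hlt
    exact absurd (lt_of_lt_of_le this h2) (lt_irrefl _)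
  refine IsLocalization.of_le S 𝔓.primeCompl hS𝔓 fun b hb => ?_
  by_contra hbu
  have : b ∈ 𝔓₀ := by
    rw [h𝔓₀, Ideal.mem_comap]
    exact (IsLocalRing.mem_maximalIdeal _).mpr hbu
  rw [← heq] at this
  exact hb this

/-! ## Birationality passes to the localization -/

/-- **Birationality localizes.** If every `z ∈ B` satisfies `d z = q(t)` for some `d ∈ A ∖ 0`
and `q ∈ A[X]`, then every element of the localization `M` of `B` at the image of `A ∖ 𝔮`
satisfies `d z = q(t)` for some `d ∈ A_𝔮 ∖ 0` and `q ∈ A_𝔮[X]` (`A` a domain). [folklore] -/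
theorem exists_mul_eq_aeval_of_isLocalization {A B O M : Type*} [CommRing A] [IsDomain A]
    [CommRing B] [CommRing O] [CommRing M] [Algebra A B] [Algebra A O] [Algebra B M]
    [Algebra O M] [Algebra A M] [IsScalarTower A B M] [IsScalarTower A O M]
    (𝔮 : Ideal A) [𝔮.IsPrime] [IsLocalization.AtPrime O 𝔮]
    [IsLocalization (Algebra.algebraMapSubmonoid B 𝔮.primeCompl) M] (t : B)
    (hbir : ∀ z : B, ∃ d : A, d ≠ 0 ∧ ∃ q : A[X], algebraMap A B d * z = aeval t q) :
    ∀ z : M, ∃ d : O, d ≠ 0 ∧ ∃ q : O[X], algebraMap O M d * z = aeval (algebraMap B M t) q := by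
  intro z
  obtain ⟨⟨b, s⟩, hz⟩ := IsLocalization.surj (Algebra.algebraMapSubmonoid B 𝔮.primeCompl) z
  obtain ⟨a₀, ha₀, hs⟩ := Submonoid.mem_map.mp s.2
  -- `z * algebraMap (algebraMap a₀) = algebraMap b`
  simp only at hz
  rw [← hs] at hz
  obtain ⟨d, hd, q, hq⟩ := hbir b
  have hinjO : Function.Injective (algebraMap A O) :=
    IsLocalization.injective O (le_nonZeroDivisors_of_noZeroDivisors
      fun h => (Ideal.mem_primeCompl_iff.mp h) (Ideal.zero_mem 𝔮))
  have ha₀u : IsUnit (algebraMap A O a₀) := IsLocalization.map_units O ⟨a₀, ha₀⟩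
  set u : O := ↑(ha₀u.unit⁻¹) with hu
  have hAM : ∀ a : A, algebraMap B M (algebraMap A B a) = algebraMap O M (algebraMap A O a) :=
    fun a => by rw [← IsScalarTower.algebraMap_apply, ← IsScalarTower.algebraMap_apply]
  refine ⟨algebraMap A O d, (map_ne_zero_iff _ hinjO).mpr hd, C u * q.map (algebraMap A O), ?_⟩
  -- `z = algebraMap b * u`
  have hzu : z = algebraMap B M b * algebraMap O M u := by
    have h1 : z * algebraMap O M (algebraMap A O a₀) = algebraMap B M b := by
      rw [← hAM]; exact hz
    calc z = z * algebraMap O M (algebraMap A O a₀ * u) := by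
            rw [hu, IsUnit.mul_val_inv, map_one, mul_one]
      _ = algebraMap B M b * algebraMap O M u := by rw [map_mul, ← mul_assoc, h1]
  rw [hzu, ← mul_assoc, ← hAM, ← map_mul, hq, map_mul, aeval_C, Polynomial.aeval_map_algebraMap,
    Polynomial.aeval_algebraMap_apply, mul_comm]

/-! ## Transport of the wound type along a localization tower -/

/-- The wound type is transported by ring isomorphisms. [folklore] -/
theorem isWoundTypeAt_iff_of_ringEquiv {D D' : Type*} [CommRing D] [CommRing D'] (e : D ≃+* D')
    (p : ℕ) (ϖ a : D) : IsWoundTypeAt p (e ϖ) (e a) ↔ IsWoundTypeAt p ϖ a := by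
  constructor
  · rintro ⟨g, u, B, hu, ha⟩
    refine ⟨e.symm g, e.symm u, B, fun c hc => hu (e c) ?_, e.injective ?_⟩
    · have := map_dvd e hc
      simpa using this
    · rw [ha]; simp
  · rintro ⟨g, u, B, hu, ha⟩
    refine ⟨e g, e u, B, fun c hc => hu (e.symm c) ?_, ?_⟩
    · have := map_dvd e.symm hc
      simpa using this
    · rw [ha]; simp

/-- **Localizing at a point, then at a boundary component through it, is localizing at the
component.** For a prime `𝔮` of `A`, `O` the localization at `𝔮`, and a prime `P` of `O`
contracting to `𝔭`, the localization of `O` at `P` is the localization of `A` at `𝔭`.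
[folklore] -/
theorem isLocalization_atPrime_of_tower {A O : Type*} [CommRing A] [CommRing O] [Algebra A O]
    (𝔭 𝔮 : Ideal A) [𝔭.IsPrime] [𝔮.IsPrime] [IsLocalization.AtPrime O 𝔮] (P : Ideal O)
    [P.IsPrime] (hP : P.comap (algebraMap A O) = 𝔭) (L : Type*) [CommRing L] [Algebra O L]
    [Algebra A L] [IsScalarTower A O L] [IsLocalization.AtPrime L P] :
    IsLocalization.AtPrime L 𝔭 := by
  have h := IsLocalization.isLocalization_isLocalization_atPrime_isLocalization 𝔮.primeCompl
    (T := L) P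
  have hS : (P.comap (algebraMap A O)).primeCompl = 𝔭.primeCompl :=
    Submonoid.ext fun y => by
      change y ∉ P.comap (algebraMap A O) ↔ y ∉ 𝔭
      rw [hP]
  change IsLocalization (P.comap (algebraMap A O)).primeCompl L at h
  rw [hS] at h
  exact h

/-- **The wound type along a boundary component does not depend on the point at which it is
read.** Let `𝔭 = (x) ≤ 𝔮₀, 𝔮` be primes of `A`, `O₀`, `O` the localizations at `𝔮₀`, `𝔮`. If
`a` is of wound type along `x` in the discrete valuation ring `(O₀)_{(x)}`, then also in
`O_{(x)}`: both are `A_𝔭`. [cite: Giraud1983, Prop. 1.5] -/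
theorem isWoundTypeAt_of_atPrime_tower {A O₀ O : Type*} [CommRing A] [CommRing O₀] [CommRing O]
    [Algebra A O₀] [Algebra A O] (𝔮₀ 𝔮 : Ideal A) [𝔮₀.IsPrime] [𝔮.IsPrime]
    [IsLocalization.AtPrime O₀ 𝔮₀] [IsLocalization.AtPrime O 𝔮] {p : ℕ} {x a : A}
    [hx : (Ideal.span {x} : Ideal A).IsPrime] (h₀ : Ideal.span {x} ≤ 𝔮₀) (h : Ideal.span {x} ≤ 𝔮)
    [hP₀ : (Ideal.span {algebraMap A O₀ x}).IsPrime] [hP : (Ideal.span {algebraMap A O x}).IsPrime]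
    (hw : IsWoundTypeAt p
      (algebraMap O₀ (Localization.AtPrime (Ideal.span {algebraMap A O₀ x})) (algebraMap A O₀ x))
      (algebraMap O₀ (Localization.AtPrime (Ideal.span {algebraMap A O₀ x})) (algebraMap A O₀ a))) :
    IsWoundTypeAt p
      (algebraMap O (Localization.AtPrime (Ideal.span {algebraMap A O x})) (algebraMap A O x))
      (algebraMap O (Localization.AtPrime (Ideal.span {algebraMap A O x})) (algebraMap A O a)) := by
  have hdisj₀ : Disjoint (𝔮₀.primeCompl : Set A) (Ideal.span {x}) := by
    rw [Set.disjoint_left]; intro y hy hy'; exact hy (h₀ hy')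
  have hdisj : Disjoint (𝔮.primeCompl : Set A) (Ideal.span {x}) := by
    rw [Set.disjoint_left]; intro y hy hy'; exact hy (h hy')
  have hmap₀ : (Ideal.span {x}).map (algebraMap A O₀) = Ideal.span {algebraMap A O₀ x} := by
    rw [Ideal.map_span, Set.image_singleton]
  have hmap : (Ideal.span {x}).map (algebraMap A O) = Ideal.span {algebraMap A O x} := by
    rw [Ideal.map_span, Set.image_singleton]
  have hc₀ : (Ideal.span {algebraMap A O₀ x}).comap (algebraMap A O₀) = Ideal.span {x} := by
    rw [← hmap₀]
    exact IsLocalization.under_map_of_isPrime_disjoint 𝔮₀.primeCompl O₀ hx hdisj₀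
  have hc : (Ideal.span {algebraMap A O x}).comap (algebraMap A O) = Ideal.span {x} := by
    rw [← hmap]
    exact IsLocalization.under_map_of_isPrime_disjoint 𝔮.primeCompl O hx hdisj
  haveI : IsLocalization.AtPrime (Localization.AtPrime (Ideal.span {algebraMap A O₀ x}))
      (Ideal.span {x}) :=
    isLocalization_atPrime_of_tower (Ideal.span {x}) 𝔮₀ _ hc₀ _
  haveI : IsLocalization.AtPrime (Localization.AtPrime (Ideal.span {algebraMap A O x}))
      (Ideal.span {x}) :=
    isLocalization_atPrime_of_tower (Ideal.span {x}) 𝔮 _ hc _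
  let e : Localization.AtPrime (Ideal.span {algebraMap A O₀ x}) ≃ₐ[A]
      Localization.AtPrime (Ideal.span {algebraMap A O x}) :=
    IsLocalization.algEquiv (Ideal.span {x}).primeCompl _ _
  have hex : e (algebraMap O₀ _ (algebraMap A O₀ x)) = algebraMap O _ (algebraMap A O x) := by
    rw [← IsScalarTower.algebraMap_apply, ← IsScalarTower.algebraMap_apply, AlgEquiv.commutes]
  have hea : e (algebraMap O₀ _ (algebraMap A O₀ a)) = algebraMap O _ (algebraMap A O a) := by
    rw [← IsScalarTower.algebraMap_apply, ← IsScalarTower.algebraMap_apply, AlgEquiv.commutes]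
  rw [← hex, ← hea]
  exact (isWoundTypeAt_iff_of_ringEquiv e.toRingEquiv p _ _).mpr hw

end Literature.AlgebraicGeometry.Resolution
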